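import Summits.QuantumFields.YangMills.Theorems.FluctuationComparisonRegPrIntLS1aAlphaMemMajorantOfRows
import Summits.QuantumFields.YangMills.Theorems.FluctuationComparisonRegPrIntLS1aLevelLawInvariance
import Literature.MathematicalPhysics.QuantumFieldTheory.Balaban1983to89.Node00.Record12MinimiserSelection
import HarnessLib

/-!
# S1a · UV3-NODE §69.11 — THE DOCKED (m2) DOOR WITH A WINDOW-CONTINUOUS MAJORANT OF (41)'s `up`: `hupc` («`up` continuous on the window») REPLACED BY «SOME `G ≥ up` on the window,
# `G ≥ low`, `G` continuous on the window» — dischargeable for constructions with sharp characteristic functions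

Cell `ym3-torus` (YM ladder rung R3 = continuum `SU(2)` Yang–Mills on the three-torus — a RUNG: NOT d = 4, NOT infinite volume, NOT a mass gap, NOT Clay).
Width seat «width 8» `ym3-torus-px8` (gen 23), FREE px helper on crux `stmt-QuantumFields-20520`, count-neutral, DEFINITION-FREE, default heartbeats; composition of
✓`…S1aAlphaMemMajorantOfRows.mem_version_of_alphaRows_majorant` with px17 g20's one-version door ✓p820698 + annex ✓p822339, exactly as ✓p822781 composes ✓p822164: the (41)-side
pointwise bound for the Γ-averaged canonical version comes from the package's OWN `Ineq41AE` + «`up K k ≤ G` on the window» + «`G` continuous on the window» (✓`canonVersion_orbAvg_le_on`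
with `g := e^{−E+Rm}·G`); everything else as ✓p822781 (with `R0`∕`Z0`∕`LFSum`∕`ChiRange` no longer needed).

WHAT — ★★★ `mem_canonVersion_of_alphaRows_majorant` (run `K`, level `k ≤ K`, `0 ≤ γ`): `BalabanUVClass.Mem (blockAvg ℰp) prm (e^{E_k}·canonVersion dU_k (orbAvg ρ_k))` from the typed (α)
schemas incl. `Ineq47AE`∕`Ineq41AE`, `hwin`, `hlowc`, the MAJORANT data (`G`, `hGlow : low ≤ G`, `hupG : up ≤ G` on the window, `hGc : ContinuousOn G` on the window), the displayed rows
δ8∕δ1∕δ4∕X⊂X̃, the displayed UNPRINTED δ2-b `hRegClass`, and the LF debt for `lf := e^{Rm}(G − low)` and `e^{E}ρ♮`.  `G := up K k` recovers ✓p822781 (given `low ≤ up`).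

WHAT THIS FILE IS NOT: a choice of `G`; nothing of Bałaban's asserted or proved; crux 20520, 19936, 19200, `YM3TorusSU2` NOT proved; no registered stub closed; rung R3 = SU(2) YM₃ on T³
— NOT d = 4, NOT infinite volume, NOT a mass gap, NOT Clay.  Sorry-free, axioms standard.

References: T. Bałaban, CMP **102** (1985) 255–275 [Balaban1985UV3] ((41)–(47) pp.266–267); CMP **98** (1985) 17–51 [Balaban1985Averaging] ((12)–(13) p.19).
-/

set_option autoImplicit false

noncomputable section

namespace Summit.QuantumFields.YangMills.Theorems.FluctuationComparisonRegPrIntLS1aAlphaMemCanonMajorantOfRows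

open Finset MeasureTheory
open scoped BigOperators
open Literature.MathematicalPhysics.QuantumFieldTheory.Balaban1983to89
open T3ContinuumYM3Torus T3UnitScaleTilt T3UnitLawDensityEML T3RestrictedUnitDensity T3AlphaInputsAC T3AlphaInputsACSchemas BalabanUVClass
open T3AlphaInputsACTwoRunLevel (LocBlockVolume)
open B10Eq38TorusDomains (IsBlockUnion bdist)
open Literature.MathematicalPhysics.QuantumFieldTheory.Balaban1983to89.Node00 (regSet canonVersion isOpen_plaqSmall)
open Literature.MathematicalPhysics.QuantumFieldTheory.Balaban1983to89.T3OrbitAverage (orbAvg)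
open Summit.QuantumFields.YangMills.Theorems.FluctuationComparisonRegPrIntLS1aAlphaMemMajorantOfRows (mem_version_of_alphaRows_majorant)
open Summit.QuantumFields.YangMills.Theorems.FluctuationComparisonRegPrIntLS1aInvariantVersion

variable {F : T3Family} {γ : ℝ}

open Classical in
/-- ★★★ **THE DOCKED (m2) DOOR WITH A WINDOW-CONTINUOUS MAJORANT** (run `K`, level `k ≤ K`): membership of `e^{E_k}·canonVersion dU_k (orbAvg ρ_k)` with the (41)-side read
through ANY `G` with `low K k ≤ G` everywhere, `up K k ≤ G` and `G` continuous on the `θBal(K−k)`-window; `lf := e^{E_k}·e^{−E_k+Rm_k}·(G − low K k)`.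
[cite: Balaban1985UV3, (41)-(47) pp.266-267; Balaban1985Averaging, (12)-(13) p.19] -/
theorem mem_canonVersion_of_alphaRows_majorant (D : AlphaDataT3 F γ) {b₀ p₀ C κ₁ C' r CD δreg δL cLF c5 : ℝ} {M₁ : ℕ} {K k : ℕ} (hk : k ≤ K)
    -- typed (α) schemas, a.e. rows included
    (hloc : IsLocal D) (hgi : GaugeInv26 D) (hts : TermSize D b₀ p₀ C κ₁) (hdec : PintDecomp D) (hadm : AdmOnSmall D b₀ p₀)
    (hLC : LocCover D κ₁ C') (hEnl : EnlBounded D M₁ r) (hBV : LocBlockVolume D)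
    (hM : MainTermIsAction D) (h47 : Ineq47AE D K k) (h41 : Ineq41AE D K k)
    (hr : 0 ≤ r) (hM1 : 1 ≤ M₁) (hMdvd : M₁ ∣ 2 * F.L ^ F.m) (hCD : 0 ≤ CD)
    -- the standing range of the coupling (δ11 is then DISCHARGED: ✓`…S1aLevelLawInvariance.resDensity_comp_gaugeAct_ae_eq`, px17 g20's annex)
    (hγ : 0 ≤ γ)
    -- §67.3 (c): the window lies in the maximal regular set of the density (a continuous representative exists there)
    (hwin : {W : GaugeField (F.P K) k (Matrix.specialUnitaryGroup (Fin 2) ℂ) | PlaqSmall (θBal F.L γ b₀ p₀ (K - k)) W} ⊆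
      regSet (fieldMeasure (F.P K) k (Matrix.specialUnitaryGroup (Fin 2) ℂ)) (resDensity F γ K Set.univ k))
    -- δ7 proper: the socket's minorant ∕ majorant are continuous on the window (print p.263 (c): activities analytic ⟹ continuous)
    (hlowc : ContinuousOn (D.low K k) {W | PlaqSmall (θBal F.L γ b₀ p₀ (K - k)) W})
    -- the (41)-side MAJORANT: `low ≤ G` everywhere, `up ≤ G` and `G` continuous on the window (`G := up K k` when `up` is window-continuous)
    (G : GaugeField (F.P K) k (Matrix.specialUnitaryGroup (Fin 2) ℂ) → ℝ)
    (hGlow : ∀ W : GaugeField (F.P K) k (Matrix.specialUnitaryGroup (Fin 2) ℂ), D.low K k W ≤ G W)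
    (hupG : ∀ W : GaugeField (F.P K) k (Matrix.specialUnitaryGroup (Fin 2) ℂ), PlaqSmall (θBal F.L γ b₀ p₀ (K - k)) W → D.up K k W ≤ G W)
    (hGc : ContinuousOn G {W | PlaqSmall (θBal F.L γ b₀ p₀ (K - k)) W})
    -- rows the socket lacks (UV3-NODE §69.2 ∕ §69.9), displayed
    (hχ1 : ∀ W : GaugeField (F.P K) k (Matrix.specialUnitaryGroup (Fin 2) ℂ), PlaqSmall (θBal F.L γ b₀ p₀ (K - k)) W → D.χ K k W = 1)
    (hBU : ∀ i, 1 ≤ i → i ≤ k → ∀ Y ∈ D.Loc K k (D.triv K k) i, IsBlockUnion (M₁ * F.L ^ i) Y)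
    (hDiam : ∀ i, 1 ≤ i → i ≤ k → ∀ Y ∈ D.Loc K k (D.triv K k) i, ∀ x ∈ Y, ∀ y ∈ Y, bdist (F.P K) M₁ i x y ≤ CD * D.treeLen K i Y)
    (hsub : ∀ K i (Y : Set (Site (F.P K) 0)), Y ⊆ D.enl K i Y)
    -- δ2-b: UNPRINTED (UV3-NODE l.426 G-K1a-1); removed by δ2-a (RULING №82)
    (hRegClass : ∀ W : GaugeField (F.P K) k (Matrix.specialUnitaryGroup (Fin 2) ℂ), PlaqSmall (θBal F.L γ b₀ p₀ (K - k)) W →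
      IsBackground (fun i => BlockAveraging.blockAvg (P := F.P K) (j := i) ℰp) {U | PlaqSmall δreg U} k W (D.Umin K k (D.triv K k) W))
    -- the large-field debt (δ9–δ10 + [B82] §3.C), in `Witness` shape, for this version
    (hlfle : ∀ W : GaugeField (F.P K) k (Matrix.specialUnitaryGroup (Fin 2) ℂ),
      Real.exp (D.Ecst K k) * (Real.exp (-(D.Ecst K k) + D.Rm K k) * (G W - D.low K k W)) ≤
        Real.exp (-cLF) * Real.exp (c5 * Fintype.card (Site (F.P K) k)))
    (hlarge : ∀ (W : GaugeField (F.P K) k (Matrix.specialUnitaryGroup (Fin 2) ℂ)) (S : Finset (Plaq (F.P K) k)),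
      (∀ p ∈ S, δL ≤ GaugeGroup.dist1 (GaugeField.plaqHol W p)) →
        Real.exp (D.Ecst K k) *
            canonVersion (fieldMeasure (F.P K) k (Matrix.specialUnitaryGroup (Fin 2) ℂ)) (orbAvg (resDensity F γ K Set.univ k)) W ≤
          Real.exp (-(cLF * S.card)) * Real.exp (c5 * Fintype.card (Site (F.P K) k))) :
    Mem (P := F.P K) (k := k) (fun i => BlockAveraging.blockAvg (P := F.P K) (j := i) ℰp)
      { δ := θBal F.L γ b₀ p₀ (K - k), δreg := δreg, δL := δL, β := (F.scheme ℰp γ).β K, κ := κ₁, M := 2 * r + 18 * M₁ + 3 + CD,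
        Ccov := max C 0 * θBal F.L γ b₀ p₀ (K - k + 1) ^ 2 * (2 * max C' 0 * (7 + 2 * r + 18 * M₁) ^ 3), cE := 0, slack := D.Rm K k,
        cLF := cLF, c5 := c5 }
      (fun W => Real.exp (D.Ecst K k) *
        canonVersion (fieldMeasure (F.P K) k (Matrix.specialUnitaryGroup (Fin 2) ℂ)) (orbAvg (resDensity F γ K Set.univ k)) W) := by
  have hinv : ∀ g : Site (F.P K) k → Matrix.specialUnitaryGroup (Fin 2) ℂ,
      (fun V => resDensity F γ K Set.univ k (GaugeField.gaugeAct g V)) =ᵐ[fieldMeasure (F.P K) k (Matrix.specialUnitaryGroup (Fin 2) ℂ)]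
        resDensity F γ K Set.univ k :=
    fun g => Summit.QuantumFields.YangMills.Theorems.FluctuationComparisonRegPrIntLS1aLevelLawInvariance.resDensity_comp_gaugeAct_ae_eq F hγ K
      (hk.trans (Nat.le_add_left K F.m)) g
  set ρk := resDensity F γ K Set.univ k with hρk
  have hρkm : Measurable ρk := measurable_resDensity F γ K MeasurableSet.univ k
  have hρk0 : ∀ V, 0 ≤ ρk V := resDensity_nonneg F γ K Set.univ k
  have hU : IsOpen {W : GaugeField (F.P K) k (Matrix.specialUnitaryGroup (Fin 2) ℂ) | PlaqSmall (θBal F.L γ b₀ p₀ (K - k)) W} := isOpen_plaqSmall _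
  -- (47′)∕(41′) pointwise on the window for the version
  have h47ρ : ∀ W : GaugeField (F.P K) k (Matrix.specialUnitaryGroup (Fin 2) ℂ), PlaqSmall (θBal F.L γ b₀ p₀ (K - k)) W →
      Real.exp (-(D.Ecst K k) - D.Rm K k) * D.low K k W ≤
        canonVersion (fieldMeasure (F.P K) k (Matrix.specialUnitaryGroup (Fin 2) ℂ)) (orbAvg ρk) W := by
    have hf : ContinuousOn (fun W => Real.exp (-(D.Ecst K k) - D.Rm K k) * D.low K k W)
        {W : GaugeField (F.P K) k (Matrix.specialUnitaryGroup (Fin 2) ℂ) | PlaqSmall (θBal F.L γ b₀ p₀ (K - k)) W} :=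
      continuousOn_const.mul hlowc
    exact le_canonVersion_orbAvg_on (N := 2) hρkm.aestronglyMeasurable hinv hU hwin hf (ae_restrict_of_ae h47)
  have h41G : ∀ W : GaugeField (F.P K) k (Matrix.specialUnitaryGroup (Fin 2) ℂ), PlaqSmall (θBal F.L γ b₀ p₀ (K - k)) W →
      canonVersion (fieldMeasure (F.P K) k (Matrix.specialUnitaryGroup (Fin 2) ℂ)) (orbAvg ρk) W ≤
        Real.exp (-(D.Ecst K k) + D.Rm K k) * G W := by
    have hg : ContinuousOn (fun W => Real.exp (-(D.Ecst K k) + D.Rm K k) * G W)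
        {W : GaugeField (F.P K) k (Matrix.specialUnitaryGroup (Fin 2) ℂ) | PlaqSmall (θBal F.L γ b₀ p₀ (K - k)) W} :=
      continuousOn_const.mul hGc
    haveI : BorelSpace (GaugeField (F.P K) k (Matrix.specialUnitaryGroup (Fin 2) ℂ)) :=
      Literature.MathematicalPhysics.QuantumFieldTheory.Balaban1983to89.T3OrbitAverage.instBorelSpaceGaugeField
    have hle : ∀ᵐ W ∂(fieldMeasure (F.P K) k (Matrix.specialUnitaryGroup (Fin 2) ℂ)).restrict
        {W : GaugeField (F.P K) k (Matrix.specialUnitaryGroup (Fin 2) ℂ) | PlaqSmall (θBal F.L γ b₀ p₀ (K - k)) W},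
        ρk W ≤ Real.exp (-(D.Ecst K k) + D.Rm K k) * G W := by
      filter_upwards [ae_restrict_of_ae h41, ae_restrict_mem (isOpen_plaqSmall _).measurableSet] with W h1 h2
      exact h1.trans (mul_le_mul_of_nonneg_left (hupG W h2) (Real.exp_nonneg _))
    exact canonVersion_orbAvg_le_on (N := 2) hρkm.aestronglyMeasurable hinv hU hwin hg hle
  exact mem_version_of_alphaRows_majorant D hk _ (canonVersion_orbAvg_nonneg (N := 2) hρk0) (measurable_canonVersion_orbAvg (N := 2) hρkm)
    (gaugeInvariant_canonVersion_orbAvg (N := 2) ρk) hloc hgi hts hdec hadm hLC hEnl hBV hM hr hM1 hMdvd hCD h47ρ G hGlow h41G hχ1 hBU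
    hDiam hsub hRegClass hlfle hlarge

end Summit.QuantumFields.YangMills.Theorems.FluctuationComparisonRegPrIntLS1aAlphaMemCanonMajorantOfRows

end
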